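import Summits.Ventures.CertifiedArithmetic.LowPrec.SRTreeLimitedBits
import HarnessLib

/-!
# Limited-randomness SR on ARBITRARY summation trees, III: dyadic orders are exact
# (venture file LXXII of the SR slice)

HONEST FRAMING: certified error envelopes and provably optimal rounding/accumulation schemes for
low-precision formats under stated cost models; every table by two implementations; no hardware or
vendor claims.

Continuation of `SRTreeLimitedBits` (the model `treeExpQ F q T f = E[f(ŝ_T)]`: every node of the
summation tree `T` rounds into the finite format `F` with a perturbed stochastic-rounding rule whose
away-from-zero probability is `q(η)` instead of the exact `η`).  This file isolates the inputs and
ORDERS on which `N` random bits lose NOTHING: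

* `Dyadic N η` (`η·2^N ∈ ℤ`, decidable, `dyadic_iff`) and `probAwayA/B/C_of_dyadic`: the three IEEE
  P3109 `N`-bit rules (`Literature.ComputerArithmetic.P3109.StochasticModes`, verbatim) reproduce
  every `N`-bit dyadic probability EXACTLY (`rnite_intCast`: round-to-nearest-integer-ties-to-even
  fixes the integers);
* `DyadicT F N T`: on every branch of the outcome tree, every node's exact up-probability is an
  `N`-bit dyadic — a structurally recursive predicate with a Boolean evaluator `dyadicTB` and a
  `Decidable` instance (kernel-checkable on concrete data);
* `stepQ_eq_step_of_dyadic`, `treeExpQ_eq_treeExp_of_dyadicT` — **dyadic orders are exact**: for ANY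
  rule `q` fixing the `N`-bit dyadics, `DyadicT F N T` makes the limited-randomness model coincide
  with the exact-SR model `treeExp F T f` of `SRTree` for EVERY test function `f` (same law, same
  mean, same variance, same tails); corollaries `treeExpQ_id_eq_exact_of_dyadicT` (unbiased under
  `NoSatT`), `stochasticA/B/C_treeExpQ_of_dyadicT`, `stochasticABC_unbiased_of_dyadicT`;
* ORDER AS A DESIGN VARIABLE under limited randomness — kernel witnesses (`decide +kernel`, FP4
  E2M1, data `(1, 1/2, 1, 3/2)`, exact sum `4`, ONE random bit): the pairwise order `bal4` and the
  left-to-right order `seq4` are NOT dyadic and are biased (`E ŝ = 15/4` under A and C, `17/4`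
  under B), whereas the right-to-left order `rcomb4 = 1 + (1/2 + (1 + 3/2))` has all three nodes
  dyadic (`rcomb4_dyadicT_oneBit`) and is exactly unbiased with the exact-SR law
  `(1/4, 5/8, 1/8)` on `{3, 4, 6}` under all three rules (`oneBit_order_decides_bias_A/B/C`,
  `oneBit_rcomb4_law_A` vs `oneBit_bal4_law_A`); with TWO bits all three orders are dyadic
  (`twoBits_all_orders_dyadicT`).  All three orders satisfy `NoSatT ∧ GapLET 2` (`pos4_flags`).
  = rows `e2m1;pos4;*` of HOME `certs/sr/gen14/treeq` (two implementations, all checks pass).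

Placement: the one-step special case is in print — El Arar–Fasi–Filip–Mikaitis (arXiv:2408.03069,
2025), Remark 2: `SR_{p,r}(x) = SR_p(x)` when `x` fits in `p + r` bits; the statement here is its
any-order, whole-law form for the P3109 rules in a finite format.  No claim beyond that.
-/

namespace Summit.Ventures.CertifiedArithmetic.LowPrec.SR.LimitedBits

open Literature.ComputerArithmetic.P3109
open Literature.ComputerArithmetic.ConnollyHighamMary2021
open Summit.Ventures.CertifiedArithmetic.LowPrec.SR
open Finset STree

section Generic

variable {K : Type*} [Field K] [LinearOrder K] [IsStrictOrderedRing K] [FloorRing K]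

/-! ### `N`-bit dyadic probabilities are reproduced exactly by the three P3109 rules -/

/-- `Dyadic N η`: `η` is an `N`-bit dyadic rational, `η · 2^N ∈ ℤ`. -/
def Dyadic (N : ℕ) (η : K) : Prop := ∃ m : ℤ, (m : K) = η * 2 ^ N

/-- Floor characterisation: `η` is an `N`-bit dyadic iff `⌊η 2^N⌋ = η 2^N`. -/
theorem dyadic_iff (N : ℕ) (η : K) : Dyadic N η ↔ ((⌊η * 2 ^ N⌋ : ℤ) : K) = η * 2 ^ N := by
  constructor
  · rintro ⟨m, hm⟩
    rw [← hm, Int.floor_intCast]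
  · intro h
    exact ⟨_, h⟩

/-- `Dyadic N η` is decidable (through `dyadic_iff`). -/
instance instDecidableDyadic (N : ℕ) (η : K) : Decidable (Dyadic N η) :=
  decidable_of_iff _ (dyadic_iff N η).symm

omit [LinearOrder K] [IsStrictOrderedRing K] [FloorRing K] in
/-- Dyadics are closed under `η ↦ 1 − η` (the negative-side reflection of `pUpQ`). -/
theorem dyadic_one_sub {N : ℕ} {η : K} (h : Dyadic N η) : Dyadic N (1 - η) := by
  obtain ⟨m, hm⟩ := h
  refine ⟨2 ^ N - m, ?_⟩
  push_cast
  rw [hm]; ring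

/-- `RNITE` fixes the integers. -/
theorem rnite_intCast (m : ℤ) : rnite ((m : K)) = m := by
  unfold rnite
  rw [Int.floor_intCast, if_pos (by linarith)]

/-- StochasticA reproduces every `N`-bit dyadic probability exactly. -/
theorem probAwayA_of_dyadic {N : ℕ} {η : K} (h : Dyadic N η) : probAwayA N η = η := by
  unfold probAwayA
  rw [(dyadic_iff N η).1 h, mul_div_assoc, div_self (by positivity), mul_one]

/-- StochasticB reproduces every `N`-bit dyadic probability exactly. -/
theorem probAwayB_of_dyadic {N : ℕ} {η : K} (h : Dyadic N η) : probAwayB N η = η := by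
  obtain ⟨m, hm⟩ := h
  have h0 : ⌊(1 / 2 : K)⌋ = 0 := by
    rw [Int.floor_eq_iff]; norm_num
  unfold probAwayB
  rw [← hm, Int.floor_intCast_add, h0, add_zero, hm, mul_div_assoc, div_self (by positivity), mul_one]

/-- StochasticC reproduces every `N`-bit dyadic probability exactly (`RNITE` fixes integers). -/
theorem probAwayC_of_dyadic {N : ℕ} {η : K} (h : Dyadic N η) : probAwayC N η = η := by
  obtain ⟨m, hm⟩ := h
  unfold probAwayC
  rw [← hm, rnite_intCast, hm, mul_div_assoc, div_self (by positivity), mul_one]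

/-! ### Dyadic trees -/

/-- `DyadicT F N T`: on every branch, every node's exact up-probability `pUp F (a + b)` is an
`N`-bit dyadic. -/
def DyadicT (F : Finset K) (N : ℕ) : STree K → Prop
  | .leaf _ => True
  | .node l r => DyadicT F N l ∧ DyadicT F N r
      ∧ AllOut F l (fun a => AllOut F r (fun b => Dyadic N (pUp F (a + b))))

/-- Boolean evaluator of `DyadicT`. -/
def dyadicTB (F : Finset K) (N : ℕ) : STree K → Bool
  | .leaf _ => true
  | .node l r => dyadicTB F N l && dyadicTB F N r
      && allOutB F l (fun a => allOutB F r (fun b => decide (Dyadic N (pUp F (a + b)))))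

/-- `dyadicTB` computes `DyadicT`. -/
theorem dyadicTB_iff (F : Finset K) (N : ℕ) : ∀ t : STree K, dyadicTB F N t = true ↔ DyadicT F N t
  | .leaf _ => by simp [dyadicTB, DyadicT]
  | .node l r => by
      simp only [dyadicTB, DyadicT, Bool.and_eq_true, dyadicTB_iff F N l, dyadicTB_iff F N r,
        and_assoc]
      refine and_congr_right fun _ => and_congr_right fun _ => ?_
      rw [allOutB_iff F l]
      refine allOut_congr F l (fun a => ?_)
      rw [allOutB_iff F r]
      exact allOut_congr F r (fun b => decide_eq_true_iff)

/-- `DyadicT` is decidable (via `dyadicTB`; kernel-checkable on concrete data). -/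
instance instDecidableDyadicT (F : Finset K) (N : ℕ) (t : STree K) : Decidable (DyadicT F N t) :=
  decidable_of_iff _ (dyadicTB_iff F N t)

/-! ### Dyadic orders are exact -/

omit [IsStrictOrderedRing K] [FloorRing K] in
/-- One node: if the exact up-probability at `c` is an `N`-bit dyadic and `q` fixes the `N`-bit
dyadics, the perturbed step IS the exact SR step (on the negative side `pUpQ` evaluates `q` at
`1 − η`, a dyadic again). -/
theorem stepQ_eq_step_of_dyadic (F : Finset K) {q : K → K} {N : ℕ}
    (hq : ∀ η, Dyadic N η → q η = η) (c : K) (f : K → K) (h : Dyadic N (pUp F c)) :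
    stepQ F q c f = step F c f := by
  have hp : pUpQ F q c = pUp F c := by
    unfold pUpQ
    split_ifs
    · exact hq _ h
    · rw [hq _ (dyadic_one_sub h)]; ring
  unfold stepQ step; rw [hp]

omit [IsStrictOrderedRing K] [FloorRing K] in
/-- **Dyadic orders are exact.** If every node of `T` is dyadic on every branch (`DyadicT F N T`)
and `q` fixes the `N`-bit dyadics, the limited-randomness model equals the exact-SR model of `SRTree`
for EVERY test function: same law, same mean, same variance, same tails. -/
theorem treeExpQ_eq_treeExp_of_dyadicT (F : Finset K) {q : K → K} {N : ℕ}
    (hq : ∀ η, Dyadic N η → q η = η) :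
    ∀ (T : STree K) (f : K → K), DyadicT F N T → treeExpQ F q T f = treeExp F T f
  | .leaf x, f, _ => rfl
  | .node l r, f, ⟨hl, hr, hall⟩ => by
      simp only [treeExpQ, treeExp]
      rw [treeExpQ_eq_treeExp_of_dyadicT F hq l _ hl]
      refine treeExp_congr_of_allOut F l (allOut_mono F l (fun a ha => ?_) hall)
      rw [treeExpQ_eq_treeExp_of_dyadicT F hq r _ hr]
      exact treeExp_congr_of_allOut F r
        (allOut_mono F r (fun b hb => stepQ_eq_step_of_dyadic F hq _ f hb) ha)

omit [IsStrictOrderedRing K] [FloorRing K] in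
/-- Hence unbiased in a dyadic order without saturation: `E_q ŝ_T = ∑ leaves` exactly. -/
theorem treeExpQ_id_eq_exact_of_dyadicT (F : Finset K) {q : K → K} {N : ℕ}
    (hq : ∀ η, Dyadic N η → q η = η) (T : STree K) (hd : DyadicT F N T) (hs : NoSatT F T) :
    treeExpQ F q T (fun v => v) = T.exact := by
  rw [treeExpQ_eq_treeExp_of_dyadicT F hq T _ hd]
  exact treeExp_id_of_noSatT F T hs

/-- StochasticA with `N` bits on an `N`-dyadic tree = exact SR, for every test function. -/
theorem stochasticA_treeExpQ_of_dyadicT (F : Finset K) (N : ℕ) (T : STree K) (hd : DyadicT F N T)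
    (f : K → K) : treeExpQ F (probAwayA N) T f = treeExp F T f :=
  treeExpQ_eq_treeExp_of_dyadicT F (fun _ h => probAwayA_of_dyadic h) T f hd

/-- StochasticB with `N` bits on an `N`-dyadic tree = exact SR, for every test function. -/
theorem stochasticB_treeExpQ_of_dyadicT (F : Finset K) (N : ℕ) (T : STree K) (hd : DyadicT F N T)
    (f : K → K) : treeExpQ F (probAwayB N) T f = treeExp F T f :=
  treeExpQ_eq_treeExp_of_dyadicT F (fun _ h => probAwayB_of_dyadic h) T f hd

/-- StochasticC with `N` bits on an `N`-dyadic tree = exact SR, for every test function. -/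
theorem stochasticC_treeExpQ_of_dyadicT (F : Finset K) (N : ℕ) (T : STree K) (hd : DyadicT F N T)
    (f : K → K) : treeExpQ F (probAwayC N) T f = treeExp F T f :=
  treeExpQ_eq_treeExp_of_dyadicT F (fun _ h => probAwayC_of_dyadic h) T f hd

/-- All three `N`-bit P3109 rules are exactly unbiased on an `N`-dyadic tree without saturation. -/
theorem stochasticABC_unbiased_of_dyadicT (F : Finset K) (N : ℕ) (T : STree K)
    (hd : DyadicT F N T) (hs : NoSatT F T) :
    treeExpQ F (probAwayA N) T (fun v => v) = T.exact ∧
    treeExpQ F (probAwayB N) T (fun v => v) = T.exact ∧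
    treeExpQ F (probAwayC N) T (fun v => v) = T.exact :=
  ⟨treeExpQ_id_eq_exact_of_dyadicT F (fun _ h => probAwayA_of_dyadic h) T hd hs,
   treeExpQ_id_eq_exact_of_dyadicT F (fun _ h => probAwayB_of_dyadic h) T hd hs,
   treeExpQ_id_eq_exact_of_dyadicT F (fun _ h => probAwayC_of_dyadic h) T hd hs⟩

end Generic

/-! ### Order as a design variable under limited randomness (FP4 kernel witnesses) -/

section Witness

open Trees

/-- The right-to-left order `a + (b + (c + d))` (right comb). -/
def rcomb4 (a b c d : ℚ) : STree ℚ := .node (.leaf a) (.node (.leaf b) (.node (.leaf c) (.leaf d)))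

/-- Data `(1, 1/2, 1, 3/2)` in FP4 E2M1 (exact sum `4`): no order saturates, every node gap `≤ 2`. -/
theorem pos4_flags :
    NoSatT FP4.e2m1 (bal4 1 (1/2) 1 (3/2)) ∧ GapLET FP4.e2m1 2 (bal4 1 (1/2) 1 (3/2)) ∧
    NoSatT FP4.e2m1 (seq4 1 (1/2) 1 (3/2)) ∧ GapLET FP4.e2m1 2 (seq4 1 (1/2) 1 (3/2)) ∧
    NoSatT FP4.e2m1 (rcomb4 1 (1/2) 1 (3/2)) ∧ GapLET FP4.e2m1 2 (rcomb4 1 (1/2) 1 (3/2)) := by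
  decide +kernel

/-- With ONE random bit only the right-to-left order is dyadic (its nodes `5/2`, `5/2 | 7/2`,
`3 | 4 | 5` all have up-probability `0` or `1/2`; the other two orders reach `9/2 ∈ (4, 6)`,
up-probability `1/4`). -/
theorem rcomb4_dyadicT_oneBit :
    DyadicT FP4.e2m1 1 (rcomb4 1 (1/2) 1 (3/2)) ∧ ¬ DyadicT FP4.e2m1 1 (bal4 1 (1/2) 1 (3/2)) ∧
    ¬ DyadicT FP4.e2m1 1 (seq4 1 (1/2) 1 (3/2)) := by
  decide +kernel

/-- With TWO random bits all three orders are dyadic (hence all exactly the exact-SR model). -/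
theorem twoBits_all_orders_dyadicT :
    DyadicT FP4.e2m1 2 (rcomb4 1 (1/2) 1 (3/2)) ∧ DyadicT FP4.e2m1 2 (bal4 1 (1/2) 1 (3/2)) ∧
    DyadicT FP4.e2m1 2 (seq4 1 (1/2) 1 (3/2)) := by
  decide +kernel

/-- **The order decides the bias (StochasticA, one bit):** pairwise and left-to-right `E ŝ = 15/4`
(bias `−1/4`), right-to-left exactly `4`. -/
theorem oneBit_order_decides_bias_A :
    treeExpQ FP4.e2m1 (probAwayA 1) (bal4 1 (1/2) 1 (3/2)) (fun v => v) = 15 / 4 ∧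
    treeExpQ FP4.e2m1 (probAwayA 1) (seq4 1 (1/2) 1 (3/2)) (fun v => v) = 15 / 4 ∧
    treeExpQ FP4.e2m1 (probAwayA 1) (rcomb4 1 (1/2) 1 (3/2)) (fun v => v) = 4 := by
  decide +kernel

/-- StochasticB, one bit: pairwise and left-to-right `E ŝ = 17/4` (bias `+1/4`), right-to-left
exactly `4`. -/
theorem oneBit_order_decides_bias_B :
    treeExpQ FP4.e2m1 (probAwayB 1) (bal4 1 (1/2) 1 (3/2)) (fun v => v) = 17 / 4 ∧
    treeExpQ FP4.e2m1 (probAwayB 1) (seq4 1 (1/2) 1 (3/2)) (fun v => v) = 17 / 4 ∧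
    treeExpQ FP4.e2m1 (probAwayB 1) (rcomb4 1 (1/2) 1 (3/2)) (fun v => v) = 4 := by
  decide +kernel

/-- StochasticC, one bit: pairwise and left-to-right `E ŝ = 15/4` (bias `−1/4`), right-to-left
exactly `4`. -/
theorem oneBit_order_decides_bias_C :
    treeExpQ FP4.e2m1 (probAwayC 1) (bal4 1 (1/2) 1 (3/2)) (fun v => v) = 15 / 4 ∧
    treeExpQ FP4.e2m1 (probAwayC 1) (seq4 1 (1/2) 1 (3/2)) (fun v => v) = 15 / 4 ∧
    treeExpQ FP4.e2m1 (probAwayC 1) (rcomb4 1 (1/2) 1 (3/2)) (fun v => v) = 4 := by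
  decide +kernel

/-- The right-to-left law under StochasticA with one bit IS the exact-SR law:
`P(ŝ = 3) = 1/4`, `P(ŝ = 4) = 5/8`, `P(ŝ = 6) = 1/8`. -/
theorem oneBit_rcomb4_law_A :
    treeExpQ FP4.e2m1 (probAwayA 1) (rcomb4 1 (1/2) 1 (3/2)) (fun v => if v = 3 then 1 else 0)
      = 1 / 4 ∧
    treeExpQ FP4.e2m1 (probAwayA 1) (rcomb4 1 (1/2) 1 (3/2)) (fun v => if v = 4 then 1 else 0)
      = 5 / 8 ∧
    treeExpQ FP4.e2m1 (probAwayA 1) (rcomb4 1 (1/2) 1 (3/2)) (fun v => if v = 6 then 1 else 0)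
      = 1 / 8 := by
  decide +kernel

/-- … whereas the pairwise law under StochasticA with one bit has lost the value `6`:
`P(ŝ = 3) = 1/4`, `P(ŝ = 4) = 3/4`, `P(ŝ = 6) = 0` (the node `9/2 ↦ 6` needs probability `1/4`). -/
theorem oneBit_bal4_law_A :
    treeExpQ FP4.e2m1 (probAwayA 1) (bal4 1 (1/2) 1 (3/2)) (fun v => if v = 3 then 1 else 0)
      = 1 / 4 ∧
    treeExpQ FP4.e2m1 (probAwayA 1) (bal4 1 (1/2) 1 (3/2)) (fun v => if v = 4 then 1 else 0)
      = 3 / 4 ∧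
    treeExpQ FP4.e2m1 (probAwayA 1) (bal4 1 (1/2) 1 (3/2)) (fun v => if v = 6 then 1 else 0)
      = 0 := by
  decide +kernel

end Witness

end Summit.Ventures.CertifiedArithmetic.LowPrec.SR.LimitedBits
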